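import Summits.BirchSwinnertonDyer.BirchSwinnertonDyer.Theses.UniversalToricDescent
import Summits.BirchSwinnertonDyer.BirchSwinnertonDyer.Theorems.UniversalToricDescentTwinSplitIMCAtThreeOfThreeFrames
import HarnessLib

/-!
# Route `UniversalToricDescent`, crux `TwinSplitIMCAtThreeMult` (stmt-BirchSwinnertonDyer-20694, bucket B = 675 twin
# classes, `3 ∥ N′`): the crux is, BY NAME and UNCONDITIONALLY, the conjunction of its two one-sided halves —
# ONE Howard-direction frame (`L ∈ Ch_Λ(X_{∅,0})·R₀⟦T⟧`) and ONE integral Wan-direction frame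
# (`Ch_Λ(X_{∅,0})·R₀⟦T⟧ ⊆ (L)`) at every datum — companion of `…TwinSplitIMCAtThreeGoodSSApZeroHalves.lean`

Seat `bsd-wall-utd-p2` g10 (LEAD prover; second item 20694, registered line `threeframes`, skeleton
a2641b3bc9bf3dbf with stubs `stub_howardFrameMult` / `stub_wanFrameMult` / `stub_thmB`; `--supports
stmt-BirchSwinnertonDyer-20694`). Crux ⟹ halves is pure logic (inlined; cf. §1 of the companion file, which this module deliberately does NOT import so as to sit directly on the route file and the route-free lattice module only); halves ⟹ crux is
`twinSplit_instance_of_two_frames` (p543791, integral cross-period rigidity). Print status at `p = 3 ∥ N′`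
under the classical Heegner hypothesis: NEITHER half is in print (Castella 2018 Thm. A and Skinner–Zhang are
`p ≥ 5` and go through a field with a non-split prime; bipartite systems are void at `p = 3` by the tree
barrier `NoAdmissiblePrimesAtThree`); even the frame (i) lacks a printed construction at `p = 3 ∥ N′`.

* `howardHalf_of_twinSplitIMCAtThreeMult`, `integralWanHalf_of_…`, `wanHalf_of_…` (= the registered stub
  signatures, `k = 0`), `twinSplitIMCAtThreeMult_of_howardHalf_of_integralWanHalf`, `twinSplitIMCAtThreeMult_iff_halves`.

HONEST FRAMING: bookkeeping theorems (crux and halves are displayed hypotheses / conclusions); nothing here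
closes an item; BSD is not proved for any curve by this file. No definition, no named fact, no `sorry`.
Beyond-print theorem: NO.

References: [Castella2018] Thm. 3.1 (frame predicate), Thm. A (`p > 3`); [SkinnerZhang2014] (`p ≥ 5`);
tree barrier `Literature.Barriers.BirchSwinnertonDyer.NoAdmissiblePrimesAtThree`.
-/

noncomputable section

open scoped Classical

set_option linter.dupNamespace false
set_option autoImplicit false

namespace Summit.BirchSwinnertonDyer.BirchSwinnertonDyer.Theorems.UniversalToricDescentTwinSplit

open PowerSeries WeierstrassCurve NumberField IsDedekindDomain Field
  Literature.NumberTheory.EllipticCurves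
  Literature.NumberTheory.EllipticCurves.ModularForms
  Literature.NumberTheory.EllipticCurves.Rank1Residual
  Summit.BirchSwinnertonDyer.Rank1Residual.X11b
  Summit.BirchSwinnertonDyer.Rank1Residual.X11b.Halves
  Summit.BirchSwinnertonDyer.BirchSwinnertonDyer.Theorems.SchneiderFree
  Summit.BirchSwinnertonDyer.BirchSwinnertonDyer.Theses.UniversalToricDescent

/-! ## `p = 3`: crux `TwinSplitIMCAtThreeMult` (20694, bucket B) ⟺ its two halves -/

section Mult

/-- **Crux B ⟹ its Howard half** (the registered stub `stub_howardFrameMult` of line `threeframes` on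
20694, verbatim). [folklore] -/
theorem howardHalf_of_twinSplitIMCAtThreeMult (h : TwinSplitIMCAtThreeMult) :
    ∀ (W' : WeierstrassCurve ℚ) [W'.IsElliptic] [W'.IsGloballyMinimal] (N' : ℕ) [NeZero N']
      (K : Type) [Field K] [NumberField K] (Dt' : ModularParametrizationData W' N'),
      Mult W' 3 → W'.HasSurjectiveModNGaloisRep 3 → W'.conductorNorm ℤ = N' →
      IsImaginaryQuadratic K → SatisfiesHeegnerHypothesis N' K → Odd (NumberField.discr K) →
      ∀ (κ : ZpExtension K 3), κ.IsAnticyclotomic → ∀ (γ : absoluteGaloisGroup K) [Fact (κ.IsTopGenerator γ)]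
        (𝔭 : HeightOneSpectrum (𝓞 K)), ((3 : ℕ) : 𝓞 K) ∈ 𝔭.asIdeal →
        𝔭.asIdeal.ramificationIdx (𝓞 ℚ) = 1 → 𝔭.asIdeal.inertiaDeg (𝓞 ℚ) = 1 →
        ∀ (𝔭' : HeightOneSpectrum (𝓞 K)), ((3 : ℕ) : 𝓞 K) ∈ 𝔭'.asIdeal → 𝔭' ≠ 𝔭 →
        ∀ (ι' : PadicAlgCl 3 ≃+* ℂ), BranchInducesPrime 3 ι' 𝔭 →
        ∃ (ΩK : ℂ) (Ωp : ℂ_[3]) (L : UnrSeries 3), ΩK ≠ 0 ∧ Ωp ≠ 0 ∧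
          IsBDPLFunction ι' 𝔭 κ γ Dt'.f ΩK Ωp L ∧
          L ∈ (AcSelmer.XAc.charIdeal (W'.baseChange K) 3 κ 𝔭' ∅ γ).map (PowerSeries.map (toUnr 3)) := by
  intro W' _ _ N' _ K _ _ Dt' hm hsurj hN' hK hH hodd κ hκ γ _ 𝔭 h𝔭 he hf 𝔭' h𝔭' hne ι' hι'
  obtain ⟨⟨ΩK, Ωp, L, hΩK, hΩp, hL⟩, hall⟩ :=
    h W' N' K Dt' hm hsurj hN' hK hH hodd κ hκ γ 𝔭 h𝔭 he hf 𝔭' h𝔭' hne ι' hι'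
  refine ⟨ΩK, Ωp, L, hΩK, hΩp, hL, ?_⟩
  rw [hall ΩK Ωp L hΩK hΩp hL]
  exact Ideal.mem_span_singleton_self L

/-- **Crux B ⟹ its INTEGRAL Wan half.** [folklore] -/
theorem integralWanHalf_of_twinSplitIMCAtThreeMult (h : TwinSplitIMCAtThreeMult) :
    ∀ (W' : WeierstrassCurve ℚ) [W'.IsElliptic] [W'.IsGloballyMinimal] (N' : ℕ) [NeZero N']
      (K : Type) [Field K] [NumberField K] (Dt' : ModularParametrizationData W' N'),
      Mult W' 3 → W'.HasSurjectiveModNGaloisRep 3 → W'.conductorNorm ℤ = N' →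
      IsImaginaryQuadratic K → SatisfiesHeegnerHypothesis N' K → Odd (NumberField.discr K) →
      ∀ (κ : ZpExtension K 3), κ.IsAnticyclotomic → ∀ (γ : absoluteGaloisGroup K) [Fact (κ.IsTopGenerator γ)]
        (𝔭 : HeightOneSpectrum (𝓞 K)), ((3 : ℕ) : 𝓞 K) ∈ 𝔭.asIdeal →
        𝔭.asIdeal.ramificationIdx (𝓞 ℚ) = 1 → 𝔭.asIdeal.inertiaDeg (𝓞 ℚ) = 1 →
        ∀ (𝔭' : HeightOneSpectrum (𝓞 K)), ((3 : ℕ) : 𝓞 K) ∈ 𝔭'.asIdeal → 𝔭' ≠ 𝔭 →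
        ∀ (ι' : PadicAlgCl 3 ≃+* ℂ), BranchInducesPrime 3 ι' 𝔭 →
        ∃ (ΩK : ℂ) (Ωp : ℂ_[3]) (L : UnrSeries 3), ΩK ≠ 0 ∧ Ωp ≠ 0 ∧
          IsBDPLFunction ι' 𝔭 κ γ Dt'.f ΩK Ωp L ∧
          (AcSelmer.XAc.charIdeal (W'.baseChange K) 3 κ 𝔭' ∅ γ).map (PowerSeries.map (toUnr 3)) ≤
            Ideal.span {L} := by
  intro W' _ _ N' _ K _ _ Dt' hm hsurj hN' hK hH hodd κ hκ γ _ 𝔭 h𝔭 he hf 𝔭' h𝔭' hne ι' hι'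
  obtain ⟨⟨ΩK, Ωp, L, hΩK, hΩp, hL⟩, hall⟩ :=
    h W' N' K Dt' hm hsurj hN' hK hH hodd κ hκ γ 𝔭 h𝔭 he hf 𝔭' h𝔭' hne ι' hι'
  exact ⟨ΩK, Ωp, L, hΩK, hΩp, hL, (hall ΩK Ωp L hΩK hΩp hL).le⟩

/-- **Crux B ⟹ its rational Wan half** (the registered stub `stub_wanFrameMult` of line `threeframes` on
20694, verbatim; `k = 0` serves). [folklore] -/
theorem wanHalf_of_twinSplitIMCAtThreeMult (h : TwinSplitIMCAtThreeMult) :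
    ∀ (W' : WeierstrassCurve ℚ) [W'.IsElliptic] [W'.IsGloballyMinimal] (N' : ℕ) [NeZero N']
      (K : Type) [Field K] [NumberField K] (Dt' : ModularParametrizationData W' N'),
      Mult W' 3 → W'.HasSurjectiveModNGaloisRep 3 → W'.conductorNorm ℤ = N' →
      IsImaginaryQuadratic K → SatisfiesHeegnerHypothesis N' K → Odd (NumberField.discr K) →
      ∀ (κ : ZpExtension K 3), κ.IsAnticyclotomic → ∀ (γ : absoluteGaloisGroup K) [Fact (κ.IsTopGenerator γ)]
        (𝔭 : HeightOneSpectrum (𝓞 K)), ((3 : ℕ) : 𝓞 K) ∈ 𝔭.asIdeal →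
        𝔭.asIdeal.ramificationIdx (𝓞 ℚ) = 1 → 𝔭.asIdeal.inertiaDeg (𝓞 ℚ) = 1 →
        ∀ (𝔭' : HeightOneSpectrum (𝓞 K)), ((3 : ℕ) : 𝓞 K) ∈ 𝔭'.asIdeal → 𝔭' ≠ 𝔭 →
        ∀ (ι' : PadicAlgCl 3 ≃+* ℂ), BranchInducesPrime 3 ι' 𝔭 →
        ∃ (ΩK : ℂ) (Ωp : ℂ_[3]) (L : UnrSeries 3), ΩK ≠ 0 ∧ Ωp ≠ 0 ∧
          IsBDPLFunction ι' 𝔭 κ γ Dt'.f ΩK Ωp L ∧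
          ∃ k : ℕ, ∀ G ∈ (AcSelmer.XAc.charIdeal (W'.baseChange K) 3 κ 𝔭' ∅ γ).map
            (PowerSeries.map (toUnr 3)), PowerSeries.C (((3 : ℕ) : unrIntegers 3) ^ k) * G ∈ Ideal.span {L} := by
  intro W' _ _ N' _ K _ _ Dt' hm hsurj hN' hK hH hodd κ hκ γ _ 𝔭 h𝔭 he hf 𝔭' h𝔭' hne ι' hι'
  obtain ⟨⟨ΩK, Ωp, L, hΩK, hΩp, hL⟩, hall⟩ :=
    h W' N' K Dt' hm hsurj hN' hK hH hodd κ hκ γ 𝔭 h𝔭 he hf 𝔭' h𝔭' hne ι' hι'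
  refine ⟨ΩK, Ωp, L, hΩK, hΩp, hL, 0, fun G hG ↦ ?_⟩
  rw [pow_zero, map_one, one_mul]
  exact (hall ΩK Ωp L hΩK hΩp hL).le hG

/-- **Howard half ∧ INTEGRAL Wan half ⟹ crux B**, UNCONDITIONALLY (`twinSplit_instance_of_two_frames`).
[cite: Castella2018, Thm. 3.1 (arXiv:1704.06608 p. 9) (the frame predicate)] -/
theorem twinSplitIMCAtThreeMult_of_howardHalf_of_integralWanHalf
    (hH : ∀ (W' : WeierstrassCurve ℚ) [W'.IsElliptic] [W'.IsGloballyMinimal] (N' : ℕ) [NeZero N']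
      (K : Type) [Field K] [NumberField K] (Dt' : ModularParametrizationData W' N'),
      Mult W' 3 → W'.HasSurjectiveModNGaloisRep 3 → W'.conductorNorm ℤ = N' →
      IsImaginaryQuadratic K → SatisfiesHeegnerHypothesis N' K → Odd (NumberField.discr K) →
      ∀ (κ : ZpExtension K 3), κ.IsAnticyclotomic → ∀ (γ : absoluteGaloisGroup K) [Fact (κ.IsTopGenerator γ)]
        (𝔭 : HeightOneSpectrum (𝓞 K)), ((3 : ℕ) : 𝓞 K) ∈ 𝔭.asIdeal →
        𝔭.asIdeal.ramificationIdx (𝓞 ℚ) = 1 → 𝔭.asIdeal.inertiaDeg (𝓞 ℚ) = 1 →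
        ∀ (𝔭' : HeightOneSpectrum (𝓞 K)), ((3 : ℕ) : 𝓞 K) ∈ 𝔭'.asIdeal → 𝔭' ≠ 𝔭 →
        ∀ (ι' : PadicAlgCl 3 ≃+* ℂ), BranchInducesPrime 3 ι' 𝔭 →
        ∃ (ΩK : ℂ) (Ωp : ℂ_[3]) (L : UnrSeries 3), ΩK ≠ 0 ∧ Ωp ≠ 0 ∧
          IsBDPLFunction ι' 𝔭 κ γ Dt'.f ΩK Ωp L ∧
          L ∈ (AcSelmer.XAc.charIdeal (W'.baseChange K) 3 κ 𝔭' ∅ γ).map (PowerSeries.map (toUnr 3)))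
    (hW : ∀ (W' : WeierstrassCurve ℚ) [W'.IsElliptic] [W'.IsGloballyMinimal] (N' : ℕ) [NeZero N']
      (K : Type) [Field K] [NumberField K] (Dt' : ModularParametrizationData W' N'),
      Mult W' 3 → W'.HasSurjectiveModNGaloisRep 3 → W'.conductorNorm ℤ = N' →
      IsImaginaryQuadratic K → SatisfiesHeegnerHypothesis N' K → Odd (NumberField.discr K) →
      ∀ (κ : ZpExtension K 3), κ.IsAnticyclotomic → ∀ (γ : absoluteGaloisGroup K) [Fact (κ.IsTopGenerator γ)]
        (𝔭 : HeightOneSpectrum (𝓞 K)), ((3 : ℕ) : 𝓞 K) ∈ 𝔭.asIdeal →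
        𝔭.asIdeal.ramificationIdx (𝓞 ℚ) = 1 → 𝔭.asIdeal.inertiaDeg (𝓞 ℚ) = 1 →
        ∀ (𝔭' : HeightOneSpectrum (𝓞 K)), ((3 : ℕ) : 𝓞 K) ∈ 𝔭'.asIdeal → 𝔭' ≠ 𝔭 →
        ∀ (ι' : PadicAlgCl 3 ≃+* ℂ), BranchInducesPrime 3 ι' 𝔭 →
        ∃ (ΩK : ℂ) (Ωp : ℂ_[3]) (L : UnrSeries 3), ΩK ≠ 0 ∧ Ωp ≠ 0 ∧
          IsBDPLFunction ι' 𝔭 κ γ Dt'.f ΩK Ωp L ∧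
          (AcSelmer.XAc.charIdeal (W'.baseChange K) 3 κ 𝔭' ∅ γ).map (PowerSeries.map (toUnr 3)) ≤
            Ideal.span {L}) :
    TwinSplitIMCAtThreeMult := by
  intro W' _ _ N' _ K _ _ Dt' hm hsurj hN' hK hH' hodd κ hκ γ _ 𝔭 h𝔭 he hf 𝔭' h𝔭' hne ι' hι'
  exact twinSplit_instance_of_two_frames W' N' K Dt' κ γ 𝔭 𝔭' ι' hK hκ
    (hH W' N' K Dt' hm hsurj hN' hK hH' hodd κ hκ γ 𝔭 h𝔭 he hf 𝔭' h𝔭' hne ι' hι')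
    (hW W' N' K Dt' hm hsurj hN' hK hH' hodd κ hκ γ 𝔭 h𝔭 he hf 𝔭' h𝔭' hne ι' hι')

/-- **THE LOSSLESS SPLIT of crux B (item 20694): `TwinSplitIMCAtThreeMult` ⟺ (Howard half at every datum)
∧ (integral Wan half at every datum)**, unconditionally and by name. Neither half is in print at `3 ∥ N′`
under the classical Heegner hypothesis (Castella 2018 / Skinner–Zhang `p ≥ 5`; bipartite systems void at
`p = 3`). [cite: Castella2018, Thm. 3.1 (arXiv:1704.06608 p. 9) (the frame predicate)] -/
theorem twinSplitIMCAtThreeMult_iff_halves :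
    TwinSplitIMCAtThreeMult ↔
    ((∀ (W' : WeierstrassCurve ℚ) [W'.IsElliptic] [W'.IsGloballyMinimal] (N' : ℕ) [NeZero N']
      (K : Type) [Field K] [NumberField K] (Dt' : ModularParametrizationData W' N'),
      Mult W' 3 → W'.HasSurjectiveModNGaloisRep 3 → W'.conductorNorm ℤ = N' →
      IsImaginaryQuadratic K → SatisfiesHeegnerHypothesis N' K → Odd (NumberField.discr K) →
      ∀ (κ : ZpExtension K 3), κ.IsAnticyclotomic → ∀ (γ : absoluteGaloisGroup K) [Fact (κ.IsTopGenerator γ)]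
        (𝔭 : HeightOneSpectrum (𝓞 K)), ((3 : ℕ) : 𝓞 K) ∈ 𝔭.asIdeal →
        𝔭.asIdeal.ramificationIdx (𝓞 ℚ) = 1 → 𝔭.asIdeal.inertiaDeg (𝓞 ℚ) = 1 →
        ∀ (𝔭' : HeightOneSpectrum (𝓞 K)), ((3 : ℕ) : 𝓞 K) ∈ 𝔭'.asIdeal → 𝔭' ≠ 𝔭 →
        ∀ (ι' : PadicAlgCl 3 ≃+* ℂ), BranchInducesPrime 3 ι' 𝔭 →
        ∃ (ΩK : ℂ) (Ωp : ℂ_[3]) (L : UnrSeries 3), ΩK ≠ 0 ∧ Ωp ≠ 0 ∧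
          IsBDPLFunction ι' 𝔭 κ γ Dt'.f ΩK Ωp L ∧
          L ∈ (AcSelmer.XAc.charIdeal (W'.baseChange K) 3 κ 𝔭' ∅ γ).map (PowerSeries.map (toUnr 3))) ∧
    (∀ (W' : WeierstrassCurve ℚ) [W'.IsElliptic] [W'.IsGloballyMinimal] (N' : ℕ) [NeZero N']
      (K : Type) [Field K] [NumberField K] (Dt' : ModularParametrizationData W' N'),
      Mult W' 3 → W'.HasSurjectiveModNGaloisRep 3 → W'.conductorNorm ℤ = N' →
      IsImaginaryQuadratic K → SatisfiesHeegnerHypothesis N' K → Odd (NumberField.discr K) →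
      ∀ (κ : ZpExtension K 3), κ.IsAnticyclotomic → ∀ (γ : absoluteGaloisGroup K) [Fact (κ.IsTopGenerator γ)]
        (𝔭 : HeightOneSpectrum (𝓞 K)), ((3 : ℕ) : 𝓞 K) ∈ 𝔭.asIdeal →
        𝔭.asIdeal.ramificationIdx (𝓞 ℚ) = 1 → 𝔭.asIdeal.inertiaDeg (𝓞 ℚ) = 1 →
        ∀ (𝔭' : HeightOneSpectrum (𝓞 K)), ((3 : ℕ) : 𝓞 K) ∈ 𝔭'.asIdeal → 𝔭' ≠ 𝔭 →
        ∀ (ι' : PadicAlgCl 3 ≃+* ℂ), BranchInducesPrime 3 ι' 𝔭 →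
        ∃ (ΩK : ℂ) (Ωp : ℂ_[3]) (L : UnrSeries 3), ΩK ≠ 0 ∧ Ωp ≠ 0 ∧
          IsBDPLFunction ι' 𝔭 κ γ Dt'.f ΩK Ωp L ∧
          (AcSelmer.XAc.charIdeal (W'.baseChange K) 3 κ 𝔭' ∅ γ).map (PowerSeries.map (toUnr 3)) ≤
            Ideal.span {L})) :=
  ⟨fun h ↦ ⟨howardHalf_of_twinSplitIMCAtThreeMult h, integralWanHalf_of_twinSplitIMCAtThreeMult h⟩,
    fun h ↦ twinSplitIMCAtThreeMult_of_howardHalf_of_integralWanHalf h.1 h.2⟩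

end Mult

end Summit.BirchSwinnertonDyer.BirchSwinnertonDyer.Theorems.UniversalToricDescentTwinSplit

end
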